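import Mathlib.RingTheory.PowerSeries.Order
import Mathlib.NumberTheory.Padics.PadicVal.Basic
import Literature.NumberTheory.EllipticCurves.PAdicLFunction
import Literature.NumberTheory.EllipticCurves.IwasawaSelmer
import Literature.NumberTheory.EllipticCurves.PAdicHeights
import Literature.NumberTheory.EllipticCurves.BSDInvariants
import HarnessLib

-- D-0014 sorry-sweep (operator, 2026-08-13): sorried theorems -> named facts `def X : Prop`; partial proofs preserved in comments
-- provenance: harness21/H21/H21/Statements/BSD/PAdicBSD.lean @ 30b6cc5 (interim HEAD d8f2665); M5 mechanical rewrite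
/-!
# BSD family — `p`-adic `L`-functions, main conjectures and `p`-adic BSD

Family `bsd`, trunk T-ELLARITH-M (group G16, outline `EllArithM`, Tier L statement file
`Statements/BSD/PAdicBSD.lean`). Throughout `W` is a globally minimal Weierstrass equation of an
elliptic curve `E/ℚ`, `p` a prime, `κ : Literature.ZpExtension ℚ p` the cyclotomic `ℤ_p`-extension
`ℚ_∞/ℚ` (`κ.IsCyclotomic`) with topological generator `γ ∈ Γ_ℚ` (`κ.IsTopGenerator γ`),
`f ∈ S₂(Γ₀(N))` the newform of `E` (`Literature.IsNewformOf W f`), `α = Literature.unitRoot W p` and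
`L_p(E, T) = Literature.padicLFunction f α ∈ ℚ_p⟦T⟧` the Mazur–Swinnerton-Dyer `p`-adic `L`-function of
the prelude file `PAdicLFunction` (variable `T = γ_cyc - 1`, `γ_cyc = 1 + p^{e₀} =
Literature.cyclotomicGenerator p`). `X = X(E/ℚ_∞)` is the Iwasawa module of a Pontryagin-dual datum
`D : W.SelmerDualData κ γ` (prelude `IwasawaSelmer`), a `Λ = ℤ_p⟦T⟧`-module with `T = γ - 1`.
This file states:

* **bsd.S20** (Kato, Astérisque 295 (2004), Thms 14.2, 17.4): `kato_divisibility` — `X(E/ℚ_∞)`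
  is `Λ`-torsion and `char_Λ X ∣ L_p(E, T)` in `Λ ⊗ ℚ_p = Λ[1/p]`, and in `Λ` if
  `ρ_{E,p} : Γ_ℚ → GL₂(ℤ_p)` is surjective; `kato_finite_of_L_one_ne_zero` —
  `L(E, 1) ≠ 0 ⇒ E(ℚ)` and `Ш(E/ℚ)[p^∞]` are finite.
* **bsd.S21** (Skinner–Urban, Invent. Math. 195 (2014): author version Thm 1 = Thm 3.6.4 =
  JOURNAL Thm 3.29; the elliptic-curve form stated here is author version Thm 3.6.9, p. 45 =
  JOURNAL Thm 3.33; the three-variable theorem Thm 3.6.1 = journal Thm 3.26 — numbering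
  concordance per ARM P D-AUDIT-r03/r04, 2026-08-26): `skinner_urban_main_conjecture` —
  `X(E/ℚ_∞)` is `Λ`-torsion,
  `char_Λ X(E/ℚ_∞) = (L_p(E, T))` in `Λ ⊗ ℚ_p = Λ[1/p]`, and in `Λ` if `ρ_{E,p} : Γ_ℚ → GL₂(ℤ_p)`
  is surjective; hypotheses copied from the accepted bsd.S30 (`Statements/BSD/LeadingTerm.lean`).
  (Restated to the printed form on 2026-08-15: the interim statement asserted the equality in
  `Λ` without the surjectivity hypothesis, see the docstring.)
* **bsd.S23** (Mazur–Swinnerton-Dyer 1974; Mazur–Tate–Teitelbaum 1986 §I):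
  `mazur_swinnertonDyer_interpolation` (the interpolation property, re-export of the prelude's
  `isPAdicLFunctionOf_padicLFunction`), `memIwasawaRat_padicLFunction` (`L_p(E, T) ∈ Λ ⊗ ℚ_p`),
  `padicLFunction_mem_iwasawaAlgebra` (`L_p(E, T) ∈ Λ` when `E[p]` is irreducible, proved here from
  the prelude's `padicLFunction_mem_integral`), and, for a prime of *split multiplicative*
  reduction, the predicate `IsSplitMultPAdicLFunctionOf` with
  `existsUnique_isSplitMultPAdicLFunctionOf` (see the design notes). The signed (Pollack 2003) and
  BDP anticyclotomic (Bertolini–Darmon–Prasanna 2013) variants are *not* stated: the prelude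
  deliberately provides no honest predicate for them (module docstring of `PAdicLFunction`), and
  this file adds none.
* **bsd.S24** (Mazur–Tate–Teitelbaum 1986, §II.10, Conj. (BSD(`p`)); Greenberg–Stevens, Invent.
  Math. 111 (1993)): `PAdicBSDConjecture W p D` (good ordinary `p`),
  `PAdicBSDConjectureExceptional W p D` (split multiplicative `p`, the exceptional-zero case), both `def … : Prop` with the `p`-adic
  height datum `D` as a parameter, and the theorem `greenberg_stevens` (the rank-`0` exceptional
  zero formula `L_p'(E, 1) = 𝓛_p(E) · L(E, 1)/Ω_E`).

## Normalisations (threaded from the prelude; MTT = Mazur–Tate–Teitelbaum 1986)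

| quantity | H21 name | normalisation |
|---|---|---|
| `[r]⁺` | `Literature.ratPlusSymbol f r` | `re(({∞,r}+{∞,-r})/2)/Ω⁺_f`, `[0]⁺ = L(E,1)/Ω⁺` (C9, §4.6) |
| `Ω⁺` | `Literature.ModularForms.plusPeriod f` | `2 · gen(re Λ_f)`, includes the real components |
| `Ω_E` | `W.realPeriodRat` (prelude `BSDInvariants`) | `(W.baseChange ℝ).realPeriod`, Néron period of minimal `W` |
| `ϖ` | bound variable `ϖ : ℚ` | `ϖ · Ω_E = Ω⁺_f`; `L_p^{MTT}(E,T) = ϖ · padicLFunction f α` |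
| `α` | `Literature.unitRoot W p` | unit root of `X² - a_p X + p` (good ordinary `p`) |
| `T` | variable of `PowerSeries ℚ_[p]` | `1 + T ↔ γ_cyc = 1 + p^{e₀}` (`e₀ = 1`; `2` if `p = 2`) |
| `L_p(E,s)` | — | `L_p(E, γ_cyc^{s-1} - 1)` (MTT §I.13): `d/ds = log_p(γ_cyc) · d/dT` at `s = 1` |
| `ε_p` | — | `(1 - α⁻¹)²` (good ordinary), `L_p(E, 0) = ε_p [0]⁺` |
| `Reg_p` | `WeierstrassCurve.padicRegulator D` | Gram determinant of `D.pairing` on a MW basis |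
| `𝓛_p` | `WeierstrassCurve.LInvariant Dq` | `log_p q_E / ord_p q_E` (Iwasawa `log_p`) |
| `Λ ↪ ℚ_p⟦T⟧` | `iwasawaToPowerSeries p` | `PowerSeries.map (algebraMap ℤ_[p] ℚ_[p])` |

MTT's conjecture BSD(`p`) (§II.10) reads, in the `s`-variable, `ord_{s=1} L_p(E,s) = r`
(`r = rank E(ℚ)`; `r + 1` in the exceptional case) and
`L_p^*(E,1) = ε_p · #Ш · Reg_p · ∏_v c_v / (#E(ℚ)_tors)²` (resp. with `ε_p` replaced by `𝓛_p(E)`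
in the exceptional case), `Reg_p` being the regulator of the canonical `p`-adic height computed with
the Iwasawa logarithm, and `L_p(E, T)` being normalised by the Néron period `Ω_E` of `E`. The
prelude's `padicLFunction f α` is normalised by `Ω⁺_f` instead, and `Ω⁺_f = ϖ · Ω_E` for a
(unique, positive) rational `ϖ` (Manin constant and lattice index of a modular parametrisation,
`ModularParametrizationData.realPeriodRat_dvd` of the prelude `ModularCurve`, not imported), so
`L_p^{MTT}(E, T) = ϖ · padicLFunction f α`; the conjectures quantify over the `ϖ : ℚ` with
`ϖ · Ω_E = Ω⁺_f`. In the `T`-variable used here the leading coefficient acquires the factor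
`log_p(γ_cyc)^r` (resp. `^{r+1}`), which we keep explicitly on the left-hand side
(Stein–Wuthrich 2013, §3, write `Reg_γ = Reg_p / log_p(γ)^r` instead). Denominators are cleared
(`· (#E(ℚ)_tors)²` on the left). Ideal-theoretic statements (bsd.S20, S21) are insensitive to
`ϖ ∈ ℚˣ` in `Λ ⊗ ℚ_p`, and in `Λ` under irreducibility of `E[p]` (`ϖ` is then a `p`-adic unit:
prelude `padicLFunction_mem_integral`, docstring); the rank-`0` exceptional zero formula
(`greenberg_stevens`) is homogeneous in `ϖ`.

## Design choices

* Group rules: `noncomputable section`, `open scoped Classical`, `namespace Literature.BSD`.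
* **The variable `T` on both sides of the main conjecture.** `SelmerDualData W κ γ` makes `X` a
  `ℤ_p⟦T⟧`-module with `T = γ - 1`, whereas `padicLFunction` is written in `T = γ_cyc - 1`,
  `γ_cyc = 1 + p^{e₀} ∈ 1 + p^{e₀}ℤ_p ≅ Gal(ℚ_∞/ℚ)` (via the cyclotomic character). The two agree
  iff `χ_p(γ) ≡ γ_cyc` modulo the torsion of `ℤ_pˣ`; this is the hypothesis
  `IsCyclotomicVariable p γ` of bsd.S20/S21 (for a cyclotomic `κ` it is compatible with
  `κ.IsTopGenerator γ` for exactly one of the unit twists `κ.unitTwist u`, cf.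
  `ZpExtension.IsCyclotomic.exists_eq_unitTwist`). Without it `char X = (L_p)` would be off by the
  automorphism `T ↦ (1+T)^u - 1` of `Λ`. The ideal `(L_p(E,T))` is stable under
  `T ↦ (1+T)⁻¹ - 1` (functional equation, MTT §I.17), so the choice `γ` versus `γ⁻¹` in the
  conjugation action `conjH1` is immaterial.
* **`Λ ⊗ ℚ_p` versus `ℚ_p⟦T⟧`.** `Λ ⊗_{ℤ_p} ℚ_p = Λ[1/p]` is the subring of `ℚ_p⟦T⟧` of series
  with bounded coefficients (`MemIwasawaRat`); divisibility "in `Λ ⊗ ℚ_p`" of principal ideals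
  `(g) ∣ (L)` is spelled `∃ n, p^n L ∈ g Λ`, i.e. `∃ n, ∃ g' ∈ char X, ι g' = p^n L`
  (NOT divisibility in the discrete valuation ring `ℚ_p⟦T⟧`, which only compares orders at `T = 0`).
  Equality `char X = (L_p)` in `Λ` is `∃ g, char X = Λ g ∧ ι g = L_p` (`ι` is injective); equality
  in `Λ ⊗ ℚ_p` is `∃ g, ∃ k ∈ ℤ, char X = Λ g ∧ ι g = p^k L_p`, because the units of `Λ[1/p]` are
  `p^ℤ · Λˣ` (`p` is a prime element of the UFD `Λ`, `Λ/p = 𝔽_p⟦T⟧`) and `Λ (v g) = Λ g` for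
  `v ∈ Λˣ`.
* **Image hypotheses.** Surjectivity of `ρ_{E,p} : Γ_ℚ → Aut(T_p E) ≅ GL₂(ℤ_p)` is spelled
  `∀ n, W.HasSurjectiveModNGaloisRep (p^n)` (surjectivity onto every `GL₂(ℤ/p^n)`, equivalent by
  compactness of the image); irreducibility of `E[p]` is G06's `HasIrreducibleModPGaloisRep`;
  "`ρ̄_{E,p}` ramified at some `ℓ ‖ N`" is transcribed through Tate's parametrisation exactly as
  in bsd.S30 (`HasMultiplicativeReductionAtPrime ℓ ∧ ¬ p ∣ v_ℓ(Δ_min)`). Reduction hypotheses at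
  the rational prime `p` use G06's `HasGoodReductionAtPrime` / `HasMultiplicativeReductionAtPrime`
  / `HasSplitMultiplicativeReductionAtPrime` and `Literature.IsOrdinaryAt W p` (outline §1, review 9e).
* **The exceptional case needs its own `L_p`.** The prelude's `msdMeasure`/`padicLFunction`
  hard-code the good-reduction Hecke polynomial `X² - a_p X + p` (trivial Nebentypus with
  `ε(p) = 1`), and `unitRoot W p` is junk at a multiplicative prime. At a prime `p ‖ N` of split
  multiplicative reduction MTT's allowable root is `α = a_p = 1`, the measure is
  `μ(a + p^m ℤ_p) = [a/p^m]⁺` (MTT §I.10 with `ε(p) = 0`), and the resulting `L_p(E,T) ∈ Λ ⊗ ℚ_p`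
  is characterised by *the same* interpolation package `IsPAdicLFunctionOf f p 1 L` of the
  prelude (`L(0) = (1 - 1)² [0]⁺ = 0 = (1 - α⁻¹)[0]⁺`, and `L(χ(γ_cyc) - 1) = ∑_a χ(a) [a/p^m]⁺`
  for `χ` of conductor `p^m`, `m ≥ 1`) together with boundedness (`MemIwasawaRat`, which makes it
  unique: a nonzero element of `Λ[1/p]` has finitely many zeros in the open unit disc by
  Weierstrass preparation, whereas e.g. `log(1+T)` vanishes at every `ζ - 1`). Hence
  `IsSplitMultPAdicLFunctionOf f p L`, the existence-and-uniqueness theorem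
  `existsUnique_isSplitMultPAdicLFunctionOf` (MTT §I.10–I.14), and the exceptional statements
  quantify over such `L`. No new measure is defined.
* **The height datum is a parameter, not universally quantified** (review 6, verbatim caveat of
  the prelude): `PAdicHeightData` axiomatises only a symmetric bilinear torsion-vanishing pairing
  `E(ℚ) × E(ℚ) → ℚ_p`, *not* the canonical cyclotomic normalisation (Schneider 1982 = Mazur–Tate
  1983 = Nekovář 1993; no `p`-adic sigma function / Coleman integration in Mathlib), so e.g. the
  zero pairing is a `PAdicHeightData`. Quantifying `∀ D` would make the leading-term clause *false*
  in rank `≥ 1` (zero regulator against a nonzero leading coefficient), and `∃ D` would make it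
  nearly vacuous; therefore, exactly as the prelude's `SchneiderConjecture D`, the conjectures are
  `PAdicBSDConjecture W p D` / `PAdicBSDConjectureExceptional W p D`, and MTT's conjecture proper
  is the instance for `D` the canonical height. This makes the formal statements weaker (parametrised)
  than MTT's conjecture. The Tate-parameter datum `Dq : TateParameterData W p` is unique
  (`TateParameterData.q_unique`) and exists iff `p` is split multiplicative
  (`nonempty_tateParameterData_iff`), so quantifying over it is harmless.
* We write `padicLFunction f (unitRoot W p)` throughout rather than the prelude's (defeq)
  abbreviation `padicLFunctionE W p hf`, so that consumers need not unfold it.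
* The signed (Pollack 2003) and BDP (2013) `p`-adic `L`-functions listed in the inventory text of
  bsd.S23 are not stated (no prelude interface); bsd.S23 is covered here only in its ordinary and
  split multiplicative parts (flagged to the architect, review item 5).
* `Finite W.sha` is a hypothesis of the leading-term clauses (as in bsd.S03/S30: `shaOrder` is a
  `Nat.card`, junk `0`).
* Mathlib search (pin v4.32.0): Mathlib has `PowerSeries.order`/`coeff`/`map`/`C`, `Padic`,
  `PadicInt` (with `Algebra ℤ_[p] ℚ_[p]`), `padicValInt`, `Module.IsTorsion`, `Ideal.span`,
  `IsOfFinOrder`, `AddCommGroup.primaryComponent` (all used); nothing on `p`-adic `L`-functions of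
  elliptic curves, Iwasawa main conjectures, Kato, Skinner–Urban or `p`-adic BSD (searched
  `padicL`, `Iwasawa`, `Selmer`, `mainConjecture`, `Kato` in `Mathlib/`).

## References

* K. Kato, *`p`-adic Hodge theory and values of zeta functions of modular forms*, Astérisque 295
  (2004), Thm 12.5, Thm 14.2, Cor. 14.3, Thm 17.4.
* C. Skinner, E. Urban, *The Iwasawa main conjectures for `GL₂`*, Invent. Math. 195 (2014) 1–277,
  Thm 1 (= author version Thm 3.6.4 = journal Thm 3.29), Thm 3.6.9 (author version, §3.6; =
  journal Thm 3.33), Thm 3.6.11 (a) (= journal Thm 3.35 (a) = Thm 2 (a)).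
* B. Mazur, P. Swinnerton-Dyer, *Arithmetic of Weil curves*, Invent. Math. 25 (1974), §§8–9.
* B. Mazur, J. Tate, J. Teitelbaum, *On `p`-adic analogues of the conjectures of Birch and
  Swinnerton-Dyer*, Invent. Math. 84 (1986), §I.10–I.14, §I.17, §II.1, §II.4, §II.10 (MTT).
* R. Greenberg, G. Stevens, *`p`-adic `L`-functions and `p`-adic periods of modular forms*, Invent.
  Math. 111 (1993) 407–447, Introduction, Thm. (0.3) (p. 407) = Thm. 7.1 (p. 444) (display (0.6),
  p. 409, is the `Λ`-adic `q`-expansion, not the theorem — locator corrected per ARM P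
  D-AUDIT-r12, 2026-08-26); S. Kobayashi,
  *An elementary proof of the Mazur–Tate–Teitelbaum conjecture for elliptic curves*, Doc. Math.
  Extra Vol. Coates (2006).
* R. Pollack, Duke Math. J. 118 (2003); M. Bertolini, H. Darmon, K. Prasanna, Duke Math. J. 162
  (2013) (variants not stated).
* W. Stein, C. Wuthrich, *Algorithms for the arithmetic of elliptic curves using Iwasawa theory*,
  Math. Comp. 82 (2013), §3, §7 (`T`-variable normalisations).
* K. Rubin, *Euler Systems*, Ann. Math. Stud. 147 (2000), Thms 2.3.2–2.3.4, §3.5.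
* R. Greenberg, *Iwasawa theory for elliptic curves*, LNM 1716 (1999), §1, §4.
-/

set_option autoImplicit false

noncomputable section

open scoped Classical MatrixGroups ModularForm

open CongruenceSubgroup WeierstrassCurve Literature.NumberTheory.EllipticCurves.ModularForms

namespace Literature.NumberTheory.EllipticCurves

/-! ### Auxiliary vocabulary: `Λ ↪ ℚ_p⟦T⟧`, `Λ ⊗ ℚ_p`, the cyclotomic variable -/

section Aux

variable (p : ℕ) [Fact p.Prime]

/-- The inclusion `ι : Λ = ℤ_p⟦T⟧ ↪ ℚ_p⟦T⟧`, coefficientwise `ℤ_p ↪ ℚ_p` (Mathlib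
`PowerSeries.map (algebraMap ℤ_[p] ℚ_[p])`). Through `ι`, `Λ ⊗_{ℤ_p} ℚ_p = Λ[1/p]` is the subring
of power series with bounded coefficients (`MemIwasawaRat`), the home of `L_p(E, T)`
(Mazur–Tate–Teitelbaum 1986, §I.12–I.13; Kato 2004, Thm 17.4). [cite: MazurTateTeitelbaum1986Invent, §I.12–I.13] -/
abbrev iwasawaToPowerSeries : IwasawaAlgebra p →+* PowerSeries ℚ_[p] :=
  PowerSeries.map (algebraMap ℤ_[p] ℚ_[p])

/-- `ι : Λ → ℚ_p⟦T⟧` is injective (`ℤ_p → ℚ_p` is; Mathlib `PowerSeries.map_injective`;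
Mazur–Tate–Teitelbaum 1986, §I.12). [cite: MazurTateTeitelbaum1986Invent, §I.12] -/
theorem iwasawaToPowerSeries_injective : Function.Injective (iwasawaToPowerSeries p) :=
  PowerSeries.map_injective _ Subtype.coe_injective

/-- `L ∈ Λ ⊗_{ℤ_p} ℚ_p = Λ[1/p] ⊆ ℚ_p⟦T⟧`: some `p^n L` has all its coefficients in `ℤ_p`, i.e.
`p^n L = ι G` for some `G ∈ Λ` (equivalently, the coefficients of `L` are bounded). This is where
`p`-adic `L`-functions of bounded measures live (Mazur–Tate–Teitelbaum 1986, §I.12; Kato 2004,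
§16–17, "`Λ ⊗ ℚ`"). [cite: MazurTateTeitelbaum1986Invent, §I.12] -/
def MemIwasawaRat (L : PowerSeries ℚ_[p]) : Prop :=
  ∃ (n : ℕ) (G : IwasawaAlgebra p), PowerSeries.C ((p : ℚ_[p]) ^ n) * L = iwasawaToPowerSeries p G

/-- Elements of `Λ` lie in `Λ ⊗ ℚ_p` (`n = 0`; Mazur–Tate–Teitelbaum 1986, §I.12). [cite: MazurTateTeitelbaum1986Invent, §I.12] -/
theorem memIwasawaRat_iwasawaToPowerSeries (G : IwasawaAlgebra p) :
    MemIwasawaRat p (iwasawaToPowerSeries p G) :=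
  ⟨0, G, by simp⟩

/-- `γ ∈ Γ_ℚ` **matches the cyclotomic variable** of `padicLFunction`: `χ_p(γ) · ζ = γ_cyc =
1 + p^{e₀}` for some torsion unit `ζ ∈ μ(ℤ_p)`, where `χ_p = Literature.GaloisRep.cyclotomicCharacter ℚ p`
and `γ_cyc = Literature.cyclotomicGenerator p`; i.e. the image of `γ` in
`Gal(ℚ_∞/ℚ) = Γ_ℚ/χ_p⁻¹(μ(ℤ_p)) ≅ ℤ_pˣ/μ ≅ 1 + p^{e₀}ℤ_p` is `γ_cyc`. Under this hypothesis the
`Λ`-module structure `T = γ - 1` of `SelmerDualData W κ γ` and the variable `T = γ_cyc - 1` of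
`L_p(E, T)` agree (Mazur–Tate–Teitelbaum 1986, §I.13; Greenberg 1999, §1, §4; see the module
docstring). For a cyclotomic `κ` this already forces the image of `γ` to generate
`Gal(ℚ_∞/ℚ)`; the additional hypothesis `κ.IsTopGenerator γ` (`κ γ = 1`) in bsd.S20/S21 is then
merely a normalisation of `κ` among its unit twists (redundant for the conclusions, which depend
on `κ` only through `ker κ`, but kept to fix notation). [cite: MazurTateTeitelbaum1986Invent, §I.13] -/
def IsCyclotomicVariable (γ : Field.absoluteGaloisGroup ℚ) : Prop :=
  ∃ ζ : ℤ_[p]ˣ, IsOfFinOrder ζ ∧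
    ((GaloisRepresentations.GaloisRep.cyclotomicCharacter ℚ p γ * ζ : ℤ_[p]ˣ) : ℤ_[p]) = (cyclotomicGenerator p : ℤ_[p])

end Aux

/-! ### bsd.S23 — the Mazur–Swinnerton-Dyer / Mazur–Tate–Teitelbaum `p`-adic `L`-function -/

section MSD

variable {W : WeierstrassCurve ℚ} [W.IsElliptic] [W.IsGloballyMinimal] {p : ℕ} [Fact p.Prime]
  {N : ℕ} [NeZero N] {f : CuspForm (Gamma0 N) 2}

/-- **bsd.S23** (the interpolation property of `L_p(E, T)`; Mazur–Swinnerton-Dyer, Invent. Math.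
25 (1974), §9; Mazur–Tate–Teitelbaum, Invent. Math. 84 (1986), §I.14, Proposition (p. 20) — the
interpolation formula `L_p(f, α, χ) = e_p(α, χ) · m^{j+1}/τ(ψ̄) · λ(f_ψ̄, z^j; 0, 1)` with the
`p`-adic multiplier `e_p(α, χ)`; §I.14 carries NO numbered display, the locator "(14.3)" formerly
written here (and still carried by sibling files, e.g. the prelude's `IsPAdicLFunctionOf`, pending
the same correction) does not exist in print: cell `bsd-cited` ARM P, D-AUDIT-r04 Q10 ADDENDUM-1
N1, page images pp. 20–21 read 2026-08-26). Let `p` be a good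
ordinary prime of `E/ℚ` (`hord`), `f` the newform of `E` (`hf`) and `α = unitRoot W p`. Then
`L_p(E, T) = padicLFunction f α ∈ ℚ_p⟦T⟧` (constructed in the prelude from the modular-symbol
measure `μ_{f,α}`, MTT §I.10, in the variable `1 + T ↔ γ_cyc = 1 + p^{e₀}`) satisfies
`IsPAdicLFunctionOf f p α`: `L_p(E, 0) = (1 - α⁻¹)² L(E, 1)/Ω⁺` and, for `χ` primitive of
conductor `p^m`, `m ≥ 1`, trivial on `μ(ℤ_p)`, `L_p(E, χ(γ_cyc) - 1) = α⁻ᵐ ∑_a χ(a) [a/p^m]⁺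
= α⁻ᵐ τ(χ) L(E, χ̄, 1)/Ω⁺` (Birch's formula, `ratTwistedSymbolSum_mul_plusPeriod`). Re-export of
the prelude's `isPAdicLFunctionOf_padicLFunction` (same statement, same provenance tag); the
interpolation package is printed, quoting [MTT, §I], as Thm. 2.2 (p. 41) of D. Delbourgo,
*Elliptic curves and big Galois representations* (2008): a unique `h_p`-admissible distribution
`μ_{f,α_p}` on `ℤ_p^×` with the displayed interpolation property at all characters of conductor
`p^n`, which is a bounded measure when `a_p(f)` is a `p`-adic unit.
[cite: MazurSwinnertonDyer1974Invent, §9] [cite: MazurTateTeitelbaum1986Invent, §I.14 Proposition (p. 20)] -/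
def mazur_swinnertonDyer_interpolation : Prop :=
  ∀ (hord : IsOrdinaryAt W p) (hf : IsNewformOf W f),
    IsPAdicLFunctionOf f p (unitRoot W p : ℚ_[p]) (padicLFunction f (unitRoot W p : ℚ_[p]))

/- interim proof relied on results that are now named facts (D-0014); demoted to a fact by the D-0014 sorry-sweep, proof preserved:
:=
  isPAdicLFunctionOf_padicLFunction hord hf
-/

/-- **bsd.S23** (`L_p(E, T) ∈ Λ ⊗ ℚ_p`; Mazur–Tate–Teitelbaum 1986, §I.11–I.13;
Mazur–Swinnerton-Dyer 1974, §8). At a good ordinary prime `μ_{f,α}` is a bounded measure (the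
`[r]⁺` have bounded denominators and `|α|_p = 1`), so `L_p(E, T)` has bounded coefficients:
`p^n L_p(E, T) ∈ Λ` for some `n`. [cite: MazurTateTeitelbaum1986Invent, §I.11–I.13] -/
def memIwasawaRat_padicLFunction : Prop :=
  ∀ (hord : IsOrdinaryAt W p) (hf : IsNewformOf W f),
    MemIwasawaRat p (padicLFunction f (unitRoot W p : ℚ_[p]))

/-- **bsd.S23** (integrality `L_p(E, T) ∈ Λ`; Greenberg–Vatsal, Invent. Math. 142 (2000),
Prop. 3.7 ("Assume either that `E` is optimal, or that `E[p]` is irreducible … Then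
`𝓛(E/ℚ, χ, T) ∈ Λ`"); Stevens, Invent. Math. 98 (1989), Thm. 4.6 (p. 93: for `p ≠ 2` and any
modular parametrisation `π : X₁(N) → A`, `c(π)·ν_A` is `𝓛(A) ⊗ ℤ_p`-valued — integrality UP TO the
Manin constant `c(π)`; unconditional integrality is Stevens' Conjecture IV (4.5), implied by his
Conjecture I (1.3) via Cor. 4.7, and p. 77 prints "we expect these to be `p`-integral, but no proof
is known at present" — (1.3) is a CONJECTURE, not a theorem, in that paper); Mazur–Tate–Teitelbaum
1986, §I.12). For `p` odd and good ordinary with `E[p]` irreducible, `L_p(E, T) = ι G` for a (unique)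
`G ∈ Λ = ℤ_p⟦T⟧`. Proved from the prelude's coefficientwise bound `padicLFunction_mem_integral`.
[cite: GreenbergVatsal2000, Prop. 3.7] [cite: Stevens1989, Thm. 4.6 and Cor. 4.7 (p. 93)] [cite: MazurTateTeitelbaum1986Invent, §I.12] -/
def padicLFunction_mem_iwasawaAlgebra : Prop :=
  ∀ (hp : p ≠ 2) (hord : IsOrdinaryAt W p) (hf : IsNewformOf W f) (hirr : W.HasIrreducibleModPGaloisRep p),
    ∃ G : IwasawaAlgebra p, iwasawaToPowerSeries p G = padicLFunction f (unitRoot W p : ℚ_[p])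

/- interim proof relied on results that are now named facts (D-0014); demoted to a fact by the D-0014 sorry-sweep, proof preserved:
:= by
  refine ⟨PowerSeries.mk fun k ↦
    ⟨padicLCoeff f (unitRoot W p : ℚ_[p]) k, padicLFunction_mem_integral hp hord hf hirr k⟩, ?_⟩
  ext k
  simp [PowerSeries.coeff_map]
-/

/-- **bsd.S23** (the `p`-adic `L`-function at a prime of split multiplicative reduction;
Mazur–Tate–Teitelbaum 1986, §I.10 (the measure `μ_{f,α}` of (10.2), p. 12, for the non-zero root
`α` of (10.1) `X² - a_p X + ε(p) p^{k-1} = X² - a_p X`, `ε(p) = 0` since `p ∣ N`), §I.12 II (i)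
(p. 16: for `p ∥ N`, `ᾱ = 0` and `α = a_p` is an allowable `p`-root, §I.11 Remark p. 14 — here
`α = a_p = 1`), §I.13–I.14 (the interpolation, §I.14 Proposition p. 20)).
`IsSplitMultPAdicLFunctionOf f p L`: `L ∈ Λ ⊗ ℚ_p` (`MemIwasawaRat`) and `L` has the interpolation
property `IsPAdicLFunctionOf f p 1 L` of the prelude with `α = 1`, which for `p ‖ N` split
multiplicative is exactly MTT's: `L(0) = (1 - α⁻¹) [0]⁺ = 0` (the exceptional zero) and
`L(χ(γ_cyc) - 1) = ∑_{a mod p^m} χ(a) [a/p^m]⁺_f = τ(χ) L(E, χ̄, 1)/Ω⁺` for `χ` primitive of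
conductor `p^m`, `m ≥ 1`, trivial on `μ(ℤ_p)` (the measure being `μ(a + p^m ℤ_p) = [a/p^m]⁺`).
Boundedness makes such `L` unique (`existsUnique_isSplitMultPAdicLFunctionOf`); the prelude's
`padicLFunction f (unitRoot W p)` is *not* this function (its measure presumes good reduction).
(Cite tag repaired 2026-08-26 — the former tag was truncated mid-locator; cell `bsd-cited` ARM P,
D-AUDIT-r04 Q10 ADDENDUM-1 N6, locators read on the page images.)
[cite: MazurTateTeitelbaum1986Invent, §I.10 (10.2) (p. 12); §I.12 II (i) (p. 16); §I.14 Proposition (p. 20)] -/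
def IsSplitMultPAdicLFunctionOf (f : CuspForm (Gamma0 N) 2) (p : ℕ) [Fact p.Prime]
    (L : PowerSeries ℚ_[p]) : Prop :=
  MemIwasawaRat p L ∧ IsPAdicLFunctionOf f p 1 L

/-- **bsd.S23** (existence and uniqueness of `L_p(E, T)` at a split multiplicative prime;
Mazur–Tate–Teitelbaum 1986, §I.10 Prop., §I.12–I.14). If `E` has split multiplicative reduction at
`p` and `f` is its newform, there is a unique `L ∈ Λ ⊗ ℚ_p` with
`IsSplitMultPAdicLFunctionOf f p L`: existence from the bounded measure
`μ(a + p^m ℤ_p) = [a/p^m]⁺` (`a_p = 1`, distribution relation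
`[r]⁺ = ∑_{u mod p} [(r+u)/p]⁺` from `U_p f = f`); uniqueness because a nonzero element of
`Λ[1/p]` has finitely many zeros in the open unit disc (Weierstrass preparation, Washington §7.1)
while two such `L` agree at all `ζ - 1`, `ζ ∈ μ_{p^∞} ∖ {1}`.
[cite: MazurTateTeitelbaum1986Invent, §I.10 Proposition (distribution property, p. 12); §I.12 II (i) (p. 16); §I.14 Proposition (p. 20)] -/
def existsUnique_isSplitMultPAdicLFunctionOf : Prop :=
  ∀ (hsplit : W.HasSplitMultiplicativeReductionAtPrime p) (hf : IsNewformOf W f),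
    ∃! L : PowerSeries ℚ_[p], IsSplitMultPAdicLFunctionOf f p L

end MSD

/-! ### bsd.S20 — Kato -/

section Kato

variable (W : WeierstrassCurve ℚ) [W.IsElliptic] [W.IsGloballyMinimal] (p : ℕ) [Fact p.Prime]
  {κ : ZpExtension ℚ p} {γ : Field.absoluteGaloisGroup ℚ} {N : ℕ} [NeZero N]
  {f : CuspForm (Gamma0 N) 2}

/-- **bsd.S20** (Kato's divisibility in the cyclotomic main conjecture; K. Kato, *`p`-adic Hodge
theory and values of zeta functions of modular forms*, Astérisque 295 (2004), Thm 17.4, with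
Thm 12.5 (4) for the integral refinement; the Euler-system bound behind both is Kato's Thm 13.4,
p. 226, "By [Pe4, Ru4, KK4]" = Perrin-Riou, Ann. Inst. Fourier 48 (1998); Rubin, *Euler Systems*,
Thms 2.3.2–2.3.4; Kato, Kodai Math. J. 22 (1999)). **Where `p ≠ 2` comes from** (provenance note,
2026-08-17; the statement below is unchanged): in the source the parity hypothesis is attached to
the INTEGRAL clause only — Thm 17.4 (3), p. 273 and Thm 13.4 (3), p. 226 ("Assume further
`p ≠ 2`"), Thm 12.5 (4), p. 222 ("Assume `p ≠ 2`, and assume that the following (12.5.2) is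
satisfied") — whereas Thm 17.4 (1)(2), Thm 13.4 (1)(2) and Rubin's `Λ`-adic Thms 2.3.2–2.3.4 carry
no parity hypothesis, and Kato keeps track of `p = 2` throughout (§12.1 on `Λ_𝔭` for `p = 2 ∈ 𝔭`;
17.13: "(17.13.1) is exact if `p ≠ 2`, and is exact upto `×2` in the case `p = 2`", harmless at the
height-one primes `𝔭 ∌ p` of clause (2)). This `def` puts `hp : p ≠ 2` in front of all three
clauses, so it is WEAKER than the printed theorem at `p = 2` (never stronger); the parity-free
clauses (1)(2) at an arbitrary prime `p`, together with an input-by-input audit of [Pe4, Ru4, KK4]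
and of Thm 16.4's sources at `p = 2`, are recorded in `KatoRankBound.lean`
(§ `KatoRankBoundAllPrimes`) and enter the tree only as the explicit hypothesis of
`kato_selmerCorank_le_order_padicLFunction_allPrimes_of_divisibility`
(`KatoRankBoundAllPrimesProofs.lean`). Let `E/ℚ` (globally minimal `W`) have good ordinary
reduction at the odd prime `p` (`hord`, `hp`), let `ℚ_∞/ℚ` be the cyclotomic `ℤ_p`-extension
(`hκ`) with topological generator `γ` (`hγ`) matching the cyclotomic variable (`hγ'`, see
`IsCyclotomicVariable`), let `f` be the newform of `E` and `X = X(E/ℚ_∞)` the Iwasawa module of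
the datum `D` (`Λ = ℤ_p⟦T⟧`, `T = γ - 1`). Then:
1. `X` is a torsion `Λ`-module (Mazur's conjecture);
2. `char_Λ X` divides `L_p(E, T)` in `Λ ⊗ ℚ_p = Λ[1/p]`: `p^n L_p(E, T) ∈ ι(char_Λ X)` for some
   `n ≥ 0`, i.e. `p^n L_p = ι g` with `g ∈ char_Λ X`;
3. if moreover `ρ_{E,p} : Γ_ℚ → Aut(T_p E) ≅ GL₂(ℤ_p)` is surjective (spelled: `ρ̄_{E,p^n}` is
   surjective for every `n`), then `char_Λ X ∣ L_p(E, T)` in `Λ`: `L_p = ι g` with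
   `g ∈ char_Λ X`.
As printed (Kato, Astérisque 295, Thm. 17.4, p. 273, for `f` good ordinary at `λ` and a
`Gal(ℚ̄/ℚ)`-stable lattice `T`): (1) `X(T)` is a torsion `Λ`-module; (2) `L_{p-adic} ∈ Λ ⊗ ℚ` and
`length_{Λ_𝔭} X(T)_𝔭 ≤ ord_𝔭 L_{p-adic}` for every height-one prime `𝔭 ∌ p`; (3) if moreover
`p ≠ 2`, condition (12.5.2) holds (the image of `Gal(ℚ̄/ℚ(ζ_{p^∞}))` contains `SL₂(ℤ_p)`,
implied by the surjectivity hypothesis here) and `ω`, `γ` are good, then `L_{p-adic} ∈ Λ` and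
the inequality holds at every height-one prime (the printed clause (3) is for `ω`, `γ` good for
some `Gal(ℚ̄/ℚ)`-stable lattice, 17.5, p. 274 — for weight `2`: `ω` a `ℤ_p`-basis of
`coLie(𝓔) ⊗ ℤ_p`, `𝓔` the Néron model, and `γ^±` bases of `T^±`, i.e. the Néron normalisation of
the `X₀(N)`-optimal curve `E₀`; it yields the `Ω⁺_f`-normalised statement used here because
`Λ(ω_{E₀}) = c₀ Λ_f` with `c₀` the Manin constant (Edixhoven 1991, Prop. 2) and `p ∤ c₀` for
`p ∤ N` (Abbes–Ullmo 1996, Thm. A; Mazur 1978, Cor. 4.1 for odd `p`) — tree facts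
`ModularForms.abbesUllmo_not_dvd_maninConstant_of_not_dvd_level` /
`ModularForms.mazur_not_dvd_maninConstant_of_odd`; so clause (3) as typed is Kato 17.4 (3) COMPOSED
with these two refereed normalisation facts, never stronger than print: cell `bsd-cited` ARM P,
D-AUDIT-r01 §3 C5′ / §7 F1, 2026-08-26). Clauses 2–3 above are the ideal-theoretic
translation (`Λ` is a UFD). [cite: Kato2004Asterisque, Thm. 17.4 (p. 273)]
[cite: AbbesUllmo1996, Thm. A] [cite: EdixhovenManin1991, Prop. 2] -/
def kato_divisibility : Prop :=
  ∀ (hp : p ≠ 2) (hord : IsOrdinaryAt W p) (hκ : κ.IsCyclotomic) (hγ : κ.IsTopGenerator γ) (hγ' : IsCyclotomicVariable p γ) (hf : IsNewformOf W f) (D : W.SelmerDualData κ γ),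
    D.IsTorsion ∧
    (∃ (n : ℕ) (g : IwasawaAlgebra p), g ∈ D.charIdeal ∧
      iwasawaToPowerSeries p g =
        PowerSeries.C ((p : ℚ_[p]) ^ n) * padicLFunction f (unitRoot W p : ℚ_[p])) ∧
    ((∀ n : ℕ, W.HasSurjectiveModNGaloisRep (p ^ n : ℕ)) →
      ∃ g ∈ D.charIdeal, iwasawaToPowerSeries p g = padicLFunction f (unitRoot W p : ℚ_[p]))

/-- **bsd.S20** (Kato's finiteness theorem; K. Kato, Astérisque 295 (2004), Thm 14.2 and Cor. 14.3
(trivial character, `K = ℚ`); Rubin, *Euler Systems*, Thm 3.5.4, Cor. 3.5.6). If `L(E, 1) ≠ 0`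
(`W.entireLFunction 1`, the entire continuation of `L(E, s)`) then `E(ℚ)` is finite and the
`p`-primary part `Ш(E/ℚ)[p^∞]` of the Tate–Shafarevich group is finite (equivalently
`Sel_{p^∞}(E/ℚ)` is finite), for every prime `p`. (Also a consequence of Gross–Zagier–Kolyvagin,
bsd.S17, which gives finiteness of all of `Ш`; Kato's proof is independent of Heegner points.)
As printed (Kato, Astérisque 295, Cor. 14.3, p. 235, of Thm. 14.2): for an abelian variety `A/ℚ`
with a surjection `J₁(N) → A`, a finite abelian `K/ℚ` and a character `χ` of `Gal(K/ℚ)` with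
`L(A, χ, 1) ≠ 0`, the `χ`-parts of `Sel(K, A)` and of `A(K)` are finite; here `A = E`
(the surjection `J₁(N_E) → E` is modularity — Breuil–Conrad–Diamond–Taylor, J. Amer. Math. Soc.
14 (2001), Thm. A: every `E/ℚ` is a quotient of `J₀(N_E)`, hence of `J₁(N_E)` through
`X₁(N) → X₀(N)` — consumed SILENTLY, not as a binder, as elsewhere in this family; the
hypothesis `W.entireLFunction 1 ≠ 0` does not smuggle it in, `entireLFunction` having a junk
value without a continuation), `K = ℚ`, `χ = 1`, and `Sel(ℚ, E) ⊇ Sel_{p^∞}(E/ℚ) ↠ Ш(E/ℚ)[p^∞]`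
(Kato's own identification of his Selmer group with the usual one, p. 235). So the decl is
Cor. 14.3 (1)+(2) per prime — WEAKER than print (no claim on the whole of `Ш`), never stronger
(print carries no parity, reduction-type, image or CM hypothesis: §14.1 "let `p` be a prime
number", §15 for CM `f`) — COMPOSED with BCDT Thm. A and the Bloch–Kato dictionary: cell
`bsd-cited` ARM P queue row Q08, sheets AUDIT-KatoCor143-ty1 / AUDIT-KatoCor143chi-ty4, referee
C2 ROUND 340 (2026-08-26): PASS — VERBATIM-COMPOSITE, this cite line endorsed there.
[cite: Kato2004Asterisque, Cor. 14.3 (p. 235)] [cite: BCDTJAMS2001, Thm. A] -/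
def kato_finite_of_L_one_ne_zero : Prop :=
  ∀ (hL : W.entireLFunction 1 ≠ 0),
    Finite W.toAffine.Point ∧ Finite (AddCommGroup.primaryComponent W.sha p) ∧
      Finite (selmerGroupPInfty W p)

end Kato

/-! ### bsd.S21 — Skinner–Urban -/

section SkinnerUrban

variable (W : WeierstrassCurve ℚ) [W.IsElliptic] [W.IsGloballyMinimal] (p : ℕ) [Fact p.Prime]
  {κ : ZpExtension ℚ p} {γ : Field.absoluteGaloisGroup ℚ} {N : ℕ} [NeZero N]
  {f : CuspForm (Gamma0 N) 2}

/-- **bsd.S21** (the cyclotomic Iwasawa main conjecture for `E/ℚ`; C. Skinner, E. Urban, *The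
Iwasawa main conjectures for `GL₂`*, Invent. Math. 195 (2014), Thm. 1 = Thm. 3.6.4, and for
elliptic curves Thm. 3.6.9 (p. 45 of the author version; = Thm. 3.33 of the journal numbering,
Invent. Math. 195 — the journal's Thm. 3.29 is Thm. 1 = 3.6.4, the newform statement); the divisibility
`char_Λ X ∣ L_p` is Kato's (bsd.S20, S–U Thm. 3.5.6) and the torsion clause is S–U Thm. 3.3.7
(p. 30, = Kato, Thm. 17.4 (1)); throughout S–U `p` is an odd prime (§1.1, p. 1)). Let `E/ℚ` be an
elliptic curve with globally minimal model `W` and `p ≥ 3` a prime such that (hypotheses copied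
from bsd.S30, `Statements/BSD/LeadingTerm.lean`): `E` has good ordinary reduction at `p` (`hgood`,
`hord : p ∤ a_p`); `ρ̄_{E,p}` is irreducible (`hirr`); and there is a prime `ℓ ≠ p` with `ℓ ‖ N_E`
at which `ρ̄_{E,p}` is ramified (`haux`, via Tate's parametrisation: multiplicative reduction at
`ℓ` and `p ∤ v_ℓ(Δ_min)`). Let `ℚ_∞/ℚ` be the cyclotomic `ℤ_p`-extension (`hκ`) with topological
generator `γ` matching the cyclotomic variable (`hγ`, `hγ'`), `f` the newform of `E`,
`L_p(E, T) = padicLFunction f α` (`α = unitRoot W p`) and `X = X(E/ℚ_∞)` the Iwasawa module of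
`D` (`Λ = ℤ_p⟦T⟧`, `T = γ - 1`). Then:
1. `X` is a torsion `Λ`-module;
2. `char_Λ X = (L_p(E, T))` in `Λ ⊗_{ℤ_p} ℚ_p = Λ[1/p]`: there are `g ∈ Λ` and `k ∈ ℤ` with
   `char_Λ X = Λ g` and `ι g = p^k · L_p(E, T)` (the units of `Λ[1/p]` are `p^ℤ · Λˣ`, `p` being
   a prime element of the UFD `Λ`, so the principal ideals of `Λ[1/p]` generated by `char_Λ X`
   and by `L_p` coincide iff some generator `g` of `char_Λ X` has `ι g = p^k L_p`, `k ∈ ℤ`; see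
   the module docstring, "`Λ ⊗ ℚ_p` versus `ℚ_p⟦T⟧`");
3. if moreover `ρ_{E,p} : Γ_ℚ → Aut(T_p E) ≅ GL₂(ℤ_p)` is surjective (spelled as in
   `kato_divisibility` (3): `ρ̄_{E,p^n}` is surjective for every `n`, equivalent by compactness
   of the image), then `char_Λ X = (L_p(E, T))` in `Λ`: there is `g ∈ Λ` with `ι g = L_p(E, T)`
   and `char_Λ X = Λ g` (in particular `L_p(E, T) ∈ Λ`).
As printed (Thm. 3.6.9, p. 45): "Assume that • `E` has good ordinary reduction at `p`;
• `ρ̄_{E,p} := ρ_{E,p} mod p` is irreducible; • there exists a prime `q‖N`, `q ≠ p` such that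
`ρ̄_{E,p}` is ramified at `q`. Then `F_E = (L_E)` in `Λ_ℚ ⊗_{ℤ_p} ℚ_p`. If the image of `ρ_{E,p}`
is surjective, then this equality holds in `Λ_ℚ`; that is, the main conjecture holds for `E`."
Here `F_E = Ch_{ℚ_∞}(T_p E, T_p E⁺)` is the characteristic ideal (S–U §3.1.6) of the dual Selmer
group, which is `D.charIdeal` for `X` torsion (clause 1), and `L_E ∈ Λ_ℚ ⊗ ℚ_p` is "the usual
`p`-adic `L`-function for `E`" (Néron-period normalisation), which differs from
`padicLFunction f α` by the factor `ϖ ∈ ℚˣ` of the module docstring (Normalisations), a `p`-adic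
unit when `E[p]` is irreducible (loc. cit.); clause 2 is insensitive to `ϖ` altogether. The
surjectivity hypothesis of clause 3 enters through Kato's integral divisibility (S–U p. 43,
Remark (ii)), which is printed for `ρ_{E,p}` surjective (Kato) and for `E[p]` reducible
(C. Wuthrich, Doc. Math. 19 (2014), Thm. 16), not under irreducibility alone (loc. cit., remark
after Cor. 19). **History.** Until 2026-08-15 this named fact asserted clause 3 without the
surjectivity hypothesis, i.e. beyond the source by the possible power of `p` (`μ`-invariant)
separating `char_Λ X` from `(L_p)`; restated to the printed form by the literature-prover
(review of 2026-08-15; no declaration in the tree consumed the old statement).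
PROOF-INPUT FLAG `SU14-12.3.6-mu@nonsplit@3` (a docstring flag priced by the referee desks on the
`p = 3` INSTANTIATION of this fact — NOT a statement change: the statement above is print's
Thm. 3.6.9 for every odd `p`, graded VERBATIM / never stronger by ARM-P reader sheet D-AUDIT-r03
`11b71c810fa7250e` (Table A, 10/10 clauses) and referee C2 R337 (V1); the flag's FULL CARRIER TEXT
— print proof chain with corpus locators, referee wording of record, retirement conditions — is
the docstring of `Skinner2016.thmC_padicValRat_bsd_rank_zero` (`Skinner2016/RankZeroPPart.lean`),
named the lane's flag-carrier of record by referee C3 R362.4 (i); this paragraph is its POINTER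
for the Skinner–Urban decl itself). PRINT PROOF CHAIN of Thm. 3.6.9 (= journal Thm. 3.33):
⇐ Thm. 3.6.4 (= Thm. 1 = journal 3.29) + Kato ⇐ Thm. 3.6.1 (= journal 3.26, the three-variable
divisibility) ⇐ Prop. 13.4.1 (ii) "follows from part (i) and Proposition 12.3.6"
[corpus:paper:doi-10-1007-s00222-013-0448-1 p0218:L5] ⇐ Prop. 12.3.6 = the µ-transfer of
¶12.3.5 ("the µ-invariant of `𝓛^{Σ,−}_{f,K,ξ}` is zero. That is, some `φ(a_i) ∈ A^×`"
[p0202:L16–L29, L52–L57]). STATUS OF THAT STEP (referee wording of record): at `p ≥ 5` — flag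
`SU14-12.3.6-mu@nonsplit` INFORMATIONAL (C2 R337.3 (β)): «µ-transfer of ¶12.3.5/Prop 12.3.6
repaired in refereed print for p ≥ 5 — @Wan15-L87/T101 (repair printed inside Wan's framework;
F = ℚ transposition = INFERENCE, no authors' erratum) | independent cover Thm103 = Thm 4 ⇐
[Fuj06, unpublished] + [BCS25] Hyp 3.1.1 (H1) (met for surjective ρ̄_{E,p})»; at `p = 3` — flag
`SU14-12.3.6-mu@nonsplit@3` **ACTIVE-PRINT-GAP** (referee A R152.2 = C2 R334 = C2 R337 = C3
R362, four independent desk readings): in the printed proof the ramified prime `q` of `haux` is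
taken inert in `K` with `q ∈ Σ`, the `w ∣ q` factor of (12.3.5.b) is `(q² − 1)/q²`, and
`3 ∣ q² − 1` for every prime `q ≠ 3`, so the µ-sentence of Prop. 12.3.6 fails in EVERY `p = 3`
instance; refereed repair at `3`: NONE located (Wan, Forum Math. Sigma 3 (2015), Thms. 86/101/103
"p ⩾ 5"; BCS IMRN 2025 "p > 3"; no S–U erratum; announced only BSTW arXiv:2409.01350v2 Thm. 1.21
(c), PRE). CONSUMERS OF THIS FACT AT `p = 3` (census ARM-P D-AUDIT-r04 ADDENDUM-1
`02adcadcba24e84e` §1, concurred by D-AUDIT-r03 ADDENDUM-1 `3d18cc764a5ef4bb`; all GOOD ORDINARY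
`3` with (irr) + (ram), i.e. inside the printed range): H1 / Partition (cell b2b-bsdres; priced per
class PUB\* at `3` by referee A, R152.2) — `RowC1.bsdp_of_mainConjectures_of_ram` /
`mazurMainConjecture_of_skinnerUrban_of_ram` (Partition/MainConjecturesRankZeroFactsDerived:
`hSU` quantified over all `p ≥ 3`, reaching `3` through the RowC1-at-`3` / semistable-corner
assemblies listed in that census), X10 `RankZeroOfTrivialPSelmer` (`hSU W 3 le_rfl`); route item
stmt-BirchSwinnertonDyer-19482 `PublishedInputsAtThree`, conjunct 4 (= THIS fact at `p = 3`
verbatim; route CountingDoorF2AtThree, rung T-r2, with the Rank2 counting-door kernels it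
discharges); the `hSU` sockets of route KimAtThreeKolyvagin
(Theorems/KimAtThreeDeepLowerOffStratumSockets, crux stmt-19679, rung W2); the per-pair rank-2 Ш
row theorem `card_shaPrimary_eq_pow_of_certificate_three` (cell b2b-bsdr2sha, dormant); U3
`CompanionKMCOfSU` (prospective); Literature-side
`Sakamoto2024.exists_isDeltaMinimal_of_skinnerUrban` (hypothesis `hSU` at `3`). The flag TRAVELS
with those uses and is priced THERE by the C-desk / referee A (PUB at `p ≥ 5`, PUB\* at
`p = 3`); no class is created or deleted by it; the multiplicative-at-`3` consumers (route
items stmt-19402 / stmt-19381) go through `Skinner2016.thmA_charIdeal_multiplicative` /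
`thmC_…`, whose docstrings carry the same flag.
RETIREMENT (R152.2 (g)): a refereed `p = 3` lower divisibility over `ℚ` — a BSTW journal version,
an S–U erratum, or an `F = ℚ` Lemma-87 analogue without "p ⩾ 5"; typed retirement target of
record = THIS decl at `p = 3` (CITED-FACTS-v2 §5 R-01: G1
`SkinnerUrban2014_thm369_cyclotomicMainConjecture_at_three` its corollary form, G2 = the S–U lower
half at `3` the item of record; EXISTING decls, no new fact).
[cite: SkinnerUrban2014, Thm. 3.6.9 (p. 45)] -/
def skinner_urban_main_conjecture : Prop :=
  ∀ (hp : 3 ≤ p) (hgood : W.HasGoodReductionAtPrime p) (hord : ¬ (p : ℤ) ∣ W.frobeniusTrace p) (hirr : W.HasIrreducibleModPGaloisRep p) (haux : ∃ ℓ : ℕ, ∃ _ : Fact ℓ.Prime, ℓ ≠ p ∧ W.HasMultiplicativeReductionAtPrime ℓ ∧ ¬ p ∣ padicValInt ℓ W.minimalDiscriminantInt) (hκ : κ.IsCyclotomic) (hγ : κ.IsTopGenerator γ) (hγ' : IsCyclotomicVariable p γ) (hf : IsNewformOf W f) (D : W.SelmerDualData κ γ),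
    D.IsTorsion ∧
    (∃ (g : IwasawaAlgebra p) (k : ℤ), D.charIdeal = Ideal.span {g} ∧
      iwasawaToPowerSeries p g =
        PowerSeries.C ((p : ℚ_[p]) ^ k) * padicLFunction f (unitRoot W p : ℚ_[p])) ∧
    ((∀ n : ℕ, W.HasSurjectiveModNGaloisRep (p ^ n : ℕ)) →
      ∃ g : IwasawaAlgebra p, iwasawaToPowerSeries p g = padicLFunction f (unitRoot W p : ℚ_[p]) ∧
        D.charIdeal = Ideal.span {g})

end SkinnerUrban

/-! ### bsd.S24 — the `p`-adic Birch–Swinnerton-Dyer conjecture -/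

section PAdicBSD

/-- **bsd.S24** (the `p`-adic Birch–Swinnerton-Dyer conjecture at a good ordinary prime;
Mazur–Tate–Teitelbaum, Invent. Math. 84 (1986), §II.10, Conj. (BSD(`p`)), non-exceptional case;
`T`-variable form as in Stein–Wuthrich, Math. Comp. 82 (2013), §3) *for the `p`-adic height datum*
`D`. If `E/ℚ` (globally minimal `W`) is good ordinary at `p`, then for the newform `f` of `E`,
`α = unitRoot W p`, `L_p(E, T) = padicLFunction f α` and `r = rank_ℤ E(ℚ)`:
(i) `ord_{T=0} L_p(E, T) = r`; and (ii) if `Ш(E/ℚ)` is finite, for the rational `ϖ` with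
`ϖ · Ω_E = Ω⁺_f` (so that `ϖ · L_p(E, T)` is MTT's `L_p` normalised by the Néron period
`Ω_E = W.realPeriodRat = (W.baseChange ℝ).realPeriod`; `ϖ` exists and is unique, see the module
docstring) the leading coefficient satisfies
`ϖ · [T^r] L_p(E, T) · log_p(γ_cyc)^r · (#E(ℚ)_tors)²
  = (1 - α⁻¹)² · #Ш(E/ℚ) · Reg_p(E, D) · ∏_v c_v`,
i.e. MTT's `L_p^*(E, 1) = ε_p · #Ш · Reg_p · ∏ c_v / #E(ℚ)_tors²` in the `s`-variable
`T = γ_cyc^{s-1} - 1` (`log_p = Literature.padicLog`, the Iwasawa logarithm; the period is already divided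
out: `ϖ · L_p(E, 0) = ε_p L(E, 1)/Ω_E`).
**Caveat (review 6, verbatim from the prelude `PAdicHeights`):** `PAdicHeightData` axiomatises only
a symmetric bilinear torsion-vanishing pairing `E(ℚ) × E(ℚ) → ℚ_p`, *not* the canonical cyclotomic
normalisation (Schneider 1982 = Mazur–Tate 1983 = Nekovář 1993; no `p`-adic sigma function /
Coleman integration in Mathlib), so e.g. the zero pairing is a `PAdicHeightData`; MTT's conjecture
proper is `PAdicBSDConjecture W p D` for `D` the canonical `p`-adic height at `p`, and with `D` a
parameter this formal statement is weaker than MTT's conjecture (quantifying `∀ D` instead would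
make it false in rank `≥ 1`). The hypotheses "`W` is an elliptic curve" and "`W` is globally minimal"
(`W.IsElliptic`, `W.IsGloballyMinimal`) are the leading instance binders *of the proposition itself*,
so the statement is only ever asserted for a globally minimal model of an elliptic curve
(`Ω_E = W.realPeriodRat` is model-dependent, `realPeriodRat_smul`). Open conjecture, stated as a
`Prop`. [cite: Schneider1982, = Mazur–Tate 1983 = Nekovář 1993] -/
def PAdicBSDConjecture (W : WeierstrassCurve ℚ) (p : ℕ) [Fact p.Prime] (D : PAdicHeightData W p) :
    Prop :=
  ∀ [W.IsElliptic] [W.IsGloballyMinimal], IsOrdinaryAt W p →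
    ∀ ⦃N : ℕ⦄ [NeZero N] (f : CuspForm (Gamma0 N) 2), IsNewformOf W f →
    (padicLFunction f (unitRoot W p : ℚ_[p])).order = W.mordellWeilRank ∧
    (Finite W.sha → ∀ ϖ : ℚ, (ϖ : ℝ) * W.realPeriodRat = plusPeriod f →
      (ϖ : ℚ_[p]) * PowerSeries.coeff W.mordellWeilRank (padicLFunction f (unitRoot W p : ℚ_[p])) *
          padicLog p (cyclotomicGenerator p) ^ W.mordellWeilRank * (W.torsionOrder : ℚ_[p]) ^ 2 =
        (1 - (unitRoot W p : ℚ_[p])⁻¹) ^ 2 *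
          (W.shaOrder * padicRegulator D * W.tamagawaProduct))

/-- **bsd.S24** (the `p`-adic Birch–Swinnerton-Dyer conjecture in the exceptional case;
Mazur–Tate–Teitelbaum, Invent. Math. 84 (1986), §II.10, Conj. (BSD(`p`)), exceptional case, with
§II.1 for `𝓛_p`; `T`-variable form as in Stein–Wuthrich (2013), §3) *for the `p`-adic height datum*
`D`. If `E/ℚ` (globally minimal `W`) has split multiplicative reduction at `p` (the *exceptional*
case: `α = a_p = 1`, `L_p(E, 0) = (1 - α⁻¹) L(E,1)/Ω⁺ = 0`), then for the Tate parameter datum `Dq`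
(unique, `TateParameterData.q_unique`), the newform `f` of `E`, the `p`-adic `L`-function
`L = L_p(E, T)` (`IsSplitMultPAdicLFunctionOf f p L`, unique) and `r = rank_ℤ E(ℚ)`:
(i) `ord_{T=0} L_p(E, T) = r + 1`; and (ii) if `Ш(E/ℚ)` is finite, for the rational `ϖ` with
`ϖ · Ω_E = Ω⁺_f` (Néron-period normalisation, see `PAdicBSDConjecture`),
`ϖ · [T^{r+1}] L_p(E, T) · log_p(γ_cyc)^{r+1} · (#E(ℚ)_tors)²
  = 𝓛_p(E) · #Ш(E/ℚ) · Reg_p(E, D) · ∏_v c_v`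
with `𝓛_p(E) = log_p q_E / ord_p q_E` (`WeierstrassCurve.LInvariant Dq`), i.e. MTT's
`L_p^*(E, 1) = 𝓛_p(E) · #Ш · Reg_p · ∏ c_v / #E(ℚ)_tors²`.
**Caveat (review 6, verbatim from the prelude `PAdicHeights`):** `PAdicHeightData` axiomatises only
a symmetric bilinear torsion-vanishing pairing `E(ℚ) × E(ℚ) → ℚ_p`, *not* the canonical cyclotomic
normalisation (Schneider 1982 = Mazur–Tate 1983 = Nekovář 1993; no `p`-adic sigma function /
Coleman integration in Mathlib), so e.g. the zero pairing is a `PAdicHeightData`; MTT's conjecture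
proper is `PAdicBSDConjectureExceptional W p D` for `D` the canonical (Schneider) `p`-adic height, and
with `D` a parameter this formal statement is weaker than MTT's conjecture. Split multiplicative
reduction at `p` is carried by `Dq.split` (no separate hypothesis; `TateParameterData W p` is empty
otherwise, `nonempty_tateParameterData_iff`), and the hypotheses `W.IsElliptic`, `W.IsGloballyMinimal`
are the leading instance binders of the proposition itself (`Ω_E = W.realPeriodRat` is
model-dependent, `realPeriodRat_smul`, so global minimality is a genuine hypothesis of the formula
even though no constant in it syntactically requires the instance). Open conjecture (known for
`r = 0`: `greenberg_stevens`), stated as a `Prop`. [cite: Schneider1982, = Mazur–Tate 1983 = Nekovář 1993] -/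
def PAdicBSDConjectureExceptional (W : WeierstrassCurve ℚ) (p : ℕ) [Fact p.Prime]
    (D : PAdicHeightData W p) : Prop :=
  ∀ [W.IsElliptic] [W.IsGloballyMinimal] (Dq : TateParameterData W p) ⦃N : ℕ⦄ [NeZero N]
    (f : CuspForm (Gamma0 N) 2), IsNewformOf W f →
    ∀ L : PowerSeries ℚ_[p], IsSplitMultPAdicLFunctionOf f p L →
      L.order = W.mordellWeilRank + 1 ∧
      (Finite W.sha → ∀ ϖ : ℚ, (ϖ : ℝ) * W.realPeriodRat = plusPeriod f →
        (ϖ : ℚ_[p]) * PowerSeries.coeff (W.mordellWeilRank + 1) L *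
            padicLog p (cyclotomicGenerator p) ^ (W.mordellWeilRank + 1) *
            (W.torsionOrder : ℚ_[p]) ^ 2 =
          LInvariant Dq * (W.shaOrder * padicRegulator D * W.tamagawaProduct))

variable (W : WeierstrassCurve ℚ) [W.IsElliptic] [W.IsGloballyMinimal] (p : ℕ) [Fact p.Prime]

/-- **bsd.S24** (the exceptional zero formula in rank `0`, i.e. the Mazur–Tate–Teitelbaum
conjecture on the first derivative; R. Greenberg, G. Stevens, *`p`-adic `L`-functions and `p`-adic
periods of modular forms*, Invent. Math. 111 (1993), Theorem of the Introduction and §7 (bib key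
`GreenbergStevens1993`; proof for `p ≥ 5` through Hida families: the two-variable `p`-adic
`L`-function `L_p(k, s)`, its functional equation, the improved `p`-adic `L`-function
`L_p(k, 1) = (1 - a_p(k)⁻¹) L_p^*(k)` and `𝓛_p(E) = -2 a_p'(2)`; the formula is printed with the
hypothesis "split multiplicative reduction at `p ≥ 5`" in D. Delbourgo, *Elliptic curves and big
Galois representations*, LMS LN 356 (2008), "Greenberg–Stevens Formula", p. 83);
S. Kobayashi, *An elementary proof of the Mazur–Tate–Teitelbaum conjecture for elliptic curves*,
Doc. Math. Extra Vol. Coates (2006), Cor. 4.2, p. 575 (for odd `p`, through Kato's element: the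
derivative formula Thm. 4.1 for the Coleman map of the Tate curve, Kato's explicit reciprocity
law (Astérisque 295, Thm. 12.5) and `Col(z^Kato)(X) = L_{p,γ}(E, X)` by Weierstrass preparation;
§2 there identifies `Γ = 1 + pℤ_p`, `Δ = μ_{p-1}`, i.e. `p` is odd); P. Colmez, *La conjecture de
Birch et Swinnerton-Dyer `p`-adique*, Sém. Bourbaki exp. 919, Astérisque 294 (2004), Thm. 0.11 and
Thm. 4.16). Let `E/ℚ` (globally minimal `W`) have split multiplicative reduction at `p` (recorded
by the Tate parameter datum `Dq`, field `split`; `nonempty_tateParameterData_iff`) and newform `f`,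
and let `L = L_p(E, T)` be its `p`-adic `L`-function (`IsSplitMultPAdicLFunctionOf f p L`). Then
`L_p(E, 0) = 0` and `L_p'(E, s)|_{s=1} = 𝓛_p(E) · L(E, 1)/Ω_E`, i.e. in the `T`-variable
`[T¹] L_p(E, T) · log_p(γ_cyc) = 𝓛_p(E) · [0]⁺_f` (Kobayashi, Cor. 4.2, first display:
`(d/dX) L_{p,γ}(E, X)|_{X=0} = (log_p κ(γ))⁻¹ · (log_p q_E / ord_p q_E) · L(E, 1)/Ω⁺_E`) with
`[0]⁺_f = L(E,1)/Ω⁺_f = ratPlusSymbol f 0` and `𝓛_p(E) = log_p q_E / ord_p q_E` (`LInvariant Dq`);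
both sides scale by the same `ϖ = Ω⁺_f/Ω_E` when passing to the Néron-period normalisation (the
measure of `L` and `[0]⁺_f` are both built from `ratPlusSymbol f`), so no period ratio appears.
**Generality flag.** The proposition quantifies over every prime `p`. The printed proofs located
cover `p ≥ 5` (Greenberg–Stevens 1993) and odd `p` (Kobayashi 2006); Colmez (2004), footnote 8,
warns "il faut probablement supposer `p ≠ 2` ou `p ≥ 5` dans certains des énoncés qui suivent au
niveau de ce qui est connu", and the Kato–Kurihara–Tsuji proof is unpublished: no printed proof
of the instance `p = 2` has been located, so at `p = 2` this named fact is at present stated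
beyond its sources (recorded by the literature-prover, 2026-08-15; statement unchanged). SCOPE OF
RECORD (ARM P D-AUDIT-r12, 2026-08-26, census-neutral): VERBATIM print at every ODD `p` — for
`p ≥ 5` Greenberg–Stevens, Introduction Thm. (0.3) (p. 407) = Thm. 7.1 (p. 444), specialised to
`f = f_E` through their (3.6)/(3.11)/(3.17); for every odd `p` (so also `p = 3`, where
Greenberg–Stevens' standing `p ≥ 5` does not apply) Kobayashi 2006 Cor. 4.2 as cited below; at
`p = 2` NO print, and every tree consumer of `greenberg_stevens (p := 2)` takes it as an OPEN
hypothesis, packaged on the Summits side as the conjecture leaf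
`MultUpperHalvesAtTwo.GreenbergStevensAtSplitTwo` (blocker B-ii of the bsd-2adic cell) — no
booking reads the `p = 2` instance as print. In
particular `ord_{T=0} L_p(E, T) = 1` iff `L(E, 1) ≠ 0`, since `𝓛_p(E) ≠ 0` (`LInvariant_ne_zero`,
Barré-Sirieix–Diaz–Gramain–Philibert 1996, bib key `BarreSirieixDiazGramainPhilibert1996Manin`).
[cite: Kobayashi2006DocMath, Cor. 4.2 (p. 575)] -/
def greenberg_stevens : Prop :=
  ∀ (Dq : TateParameterData W p) {N : ℕ} [NeZero N] {f : CuspForm (Gamma0 N) 2} (hf : IsNewformOf W f) {L : PowerSeries ℚ_[p]} (hL : IsSplitMultPAdicLFunctionOf f p L),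
    PowerSeries.constantCoeff L = 0 ∧
      PowerSeries.coeff 1 L * padicLog p (cyclotomicGenerator p) =
        LInvariant Dq * (ratPlusSymbol f 0 : ℚ_[p])

variable {p} in
/-- The exceptional zero is automatic: any `L` with `IsSplitMultPAdicLFunctionOf f p L` has
`L(0) = (1 - 1)² [0]⁺ = 0` (first clause of `IsPAdicLFunctionOf` with `α = 1`;
Mazur–Tate–Teitelbaum 1986, §I.15, Proposition, case I (p. 21): `k` even, `p ∥ N`, `j = (k-2)/2`).
[cite: MazurTateTeitelbaum1986Invent, §I.15 Proposition, case I (p. 21)] -/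
theorem IsSplitMultPAdicLFunctionOf.constantCoeff_eq_zero {N : ℕ} {f : CuspForm (Gamma0 N) 2}
    {L : PowerSeries ℚ_[p]} (hL : IsSplitMultPAdicLFunctionOf f p L) :
    PowerSeries.constantCoeff L = 0 := by
  have h := hL.2.1
  simpa using h

end PAdicBSD

end Literature.NumberTheory.EllipticCurves

end
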